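import Summits.Ventures.QEC.Census.FoldTowerPlan
import HarnessLib

/-!
# Fold certificate of `[[288,12,18]]` — BASE: all weight ≤ 16 words of ker H^X(C18) are `T18` classes

Exhaustive kernel check over the `2^18` words of the 18-qubit bottom code `C18` (`baseCheck2`, `FoldDefs`; soundness
`matched_of_baseCheck2`, `FoldDriver`): syndrome and weight by 9-bit half tables, canonical form = minimal translate by
8 translation table pairs, membership in the `T18` store; the tables are the data of `FoldTowerPlan`, each checked here against its
specification before use. Result `complete18`.
-/

set_option maxRecDepth 100000

namespace Summit.Ventures.QEC.Census.Fold.Tower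

open Summit.Ventures.QEC.Census Summit.Ventures.QEC.Census.Fold

/-- `bsl` (kernel computation / assembly step; see the module docstring). -/
theorem bsl : ∀ x, x < 2 ^ 9 → tab BSL 18 x = lin C18.col 9 0 x := by decide +kernel
/-- `bsr` (kernel computation / assembly step; see the module docstring). -/
theorem bsr : ∀ x, x < 2 ^ 9 → tab BSR 18 x = lin C18.col 9 9 x := by decide +kernel
/-- `bpl` (kernel computation / assembly step; see the module docstring). -/
theorem bpl : ∀ x, x < 2 ^ 9 → tab BPL 8 x = popc 9 x := by decide +kernel
/-- `btl0` (kernel computation / assembly step; see the module docstring). -/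
theorem btl0 : ∀ x, x < 2 ^ 9 → tab BTL0 18 x = lin (fun J => 2 ^ transIdx 3 3 0 1 J) 9 0 x := by decide +kernel
/-- `btr0` (kernel computation / assembly step; see the module docstring). -/
theorem btr0 : ∀ x, x < 2 ^ 9 → tab BTR0 18 x = lin (fun J => 2 ^ transIdx 3 3 0 1 J) 9 9 x := by decide +kernel
/-- `btl1` (kernel computation / assembly step; see the module docstring). -/
theorem btl1 : ∀ x, x < 2 ^ 9 → tab BTL1 18 x = lin (fun J => 2 ^ transIdx 3 3 0 2 J) 9 0 x := by decide +kernel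
/-- `btr1` (kernel computation / assembly step; see the module docstring). -/
theorem btr1 : ∀ x, x < 2 ^ 9 → tab BTR1 18 x = lin (fun J => 2 ^ transIdx 3 3 0 2 J) 9 9 x := by decide +kernel
/-- `btl2` (kernel computation / assembly step; see the module docstring). -/
theorem btl2 : ∀ x, x < 2 ^ 9 → tab BTL2 18 x = lin (fun J => 2 ^ transIdx 3 3 1 0 J) 9 0 x := by decide +kernel
/-- `btr2` (kernel computation / assembly step; see the module docstring). -/
theorem btr2 : ∀ x, x < 2 ^ 9 → tab BTR2 18 x = lin (fun J => 2 ^ transIdx 3 3 1 0 J) 9 9 x := by decide +kernel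
/-- `btl3` (kernel computation / assembly step; see the module docstring). -/
theorem btl3 : ∀ x, x < 2 ^ 9 → tab BTL3 18 x = lin (fun J => 2 ^ transIdx 3 3 1 1 J) 9 0 x := by decide +kernel
/-- `btr3` (kernel computation / assembly step; see the module docstring). -/
theorem btr3 : ∀ x, x < 2 ^ 9 → tab BTR3 18 x = lin (fun J => 2 ^ transIdx 3 3 1 1 J) 9 9 x := by decide +kernel
/-- `btl4` (kernel computation / assembly step; see the module docstring). -/
theorem btl4 : ∀ x, x < 2 ^ 9 → tab BTL4 18 x = lin (fun J => 2 ^ transIdx 3 3 1 2 J) 9 0 x := by decide +kernel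
/-- `btr4` (kernel computation / assembly step; see the module docstring). -/
theorem btr4 : ∀ x, x < 2 ^ 9 → tab BTR4 18 x = lin (fun J => 2 ^ transIdx 3 3 1 2 J) 9 9 x := by decide +kernel
/-- `btl5` (kernel computation / assembly step; see the module docstring). -/
theorem btl5 : ∀ x, x < 2 ^ 9 → tab BTL5 18 x = lin (fun J => 2 ^ transIdx 3 3 2 0 J) 9 0 x := by decide +kernel
/-- `btr5` (kernel computation / assembly step; see the module docstring). -/
theorem btr5 : ∀ x, x < 2 ^ 9 → tab BTR5 18 x = lin (fun J => 2 ^ transIdx 3 3 2 0 J) 9 9 x := by decide +kernel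
/-- `btl6` (kernel computation / assembly step; see the module docstring). -/
theorem btl6 : ∀ x, x < 2 ^ 9 → tab BTL6 18 x = lin (fun J => 2 ^ transIdx 3 3 2 1 J) 9 0 x := by decide +kernel
/-- `btr6` (kernel computation / assembly step; see the module docstring). -/
theorem btr6 : ∀ x, x < 2 ^ 9 → tab BTR6 18 x = lin (fun J => 2 ^ transIdx 3 3 2 1 J) 9 9 x := by decide +kernel
/-- `btl7` (kernel computation / assembly step; see the module docstring). -/
theorem btl7 : ∀ x, x < 2 ^ 9 → tab BTL7 18 x = lin (fun J => 2 ^ transIdx 3 3 2 2 J) 9 0 x := by decide +kernel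
/-- `btr7` (kernel computation / assembly step; see the module docstring). -/
theorem btr7 : ∀ x, x < 2 ^ 9 → tab BTR7 18 x = lin (fun J => 2 ^ transIdx 3 3 2 2 J) 9 9 x := by decide +kernel

/-- the translation tables compute `transW` (split at bit 9). -/
theorem btrs : ∀ i, i < BTRS.length → ∀ u, u < 2 ^ (2 * (C18.l * C18.m)) →
    tab (BTRS.getD i (0,0)).1 18 (u % 2 ^ 9) ^^^ tab (BTRS.getD i (0,0)).2 18 (u / 2 ^ 9) =
      transW C18.l C18.m (BDS.getD i (0,0)).1 (BDS.getD i (0,0)).2 u := by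
  intro i hi u hu
  have hl : u % 2 ^ 9 < 2 ^ 9 := Nat.mod_lt _ (by decide)
  have hh : u / 2 ^ 9 < 2 ^ 9 := by
    change u < 2 ^ 18 at hu; omega
  have e : (2 * (3 * 3) : ℕ) = 9 + 9 := rfl
  have key : ∀ (da db : ℕ), transW 3 3 da db u =
      lin (fun J => 2 ^ transIdx 3 3 da db J) 9 0 (u % 2 ^ 9) ^^^ lin (fun J => 2 ^ transIdx 3 3 da db J) 9 9 (u / 2 ^ 9) := by
    intro da db; rw [transW, e, lin_split]
  change i < 8 at hi
  interval_cases i <;> simp only [BTRS, BDS, List.getD_cons_succ, List.getD_cons_zero] <;>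
    first | (rw [btl0 _ hl, btr0 _ hh]; exact (key _ _).symm) | (rw [btl1 _ hl, btr1 _ hh]; exact (key _ _).symm) | (rw [btl2 _ hl, btr2 _ hh]; exact (key _ _).symm) | (rw [btl3 _ hl, btr3 _ hh]; exact (key _ _).symm) | (rw [btl4 _ hl, btr4 _ hh]; exact (key _ _).symm) | (rw [btl5 _ hl, btr5 _ hh]; exact (key _ _).symm) | (rw [btl6 _ hl, btr6 _ hh]; exact (key _ _).symm) | (rw [btl7 _ hl, btr7 _ hh]; exact (key _ _).symm)

set_option maxHeartbeats 400000000 in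
/-- THE BASE RUN: `2^18` words. -/
theorem base_run : baseCheck2 BSL BSR BPL BPL 18 9 16 md18 BTRS (repStore md18 T18) 0 (2 ^ 18) = true := by
  decide +kernel

/-- **Complete18**: every word of `ker H^X(C18)` of weight `≤ 16` is a translate of a `T18` representative. -/
theorem complete18 : ∀ u, u < 2 ^ 18 → C18.ker 18 u → popc 18 u ≤ 16 → Matched 3 3 T18 u := by
  intro u hu hk hw
  exact matched_of_baseCheck2 (C := C18) (k := 9) (w := 18) (W := 16) (md := md18) rfl (by decide) (by decide)
    bsl bsr bpl bpl (trs := BTRS) (ds := BDS) btrs rfl (reps := T18) (by decide +kernel) (lo := 0) (cnt := 2 ^ 18) (by decide)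
    base_run u (Nat.zero_le _) (by simpa using hu) hk hw

end Summit.Ventures.QEC.Census.Fold.Tower
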